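import Summits.AtomisticToContinuum.HydrodynamicLimit.Theses.JParityClosure
import Summits.AtomisticToContinuum.HydrodynamicLimit.Theorems.JParityClosureOddContactSymmetryKineticSlabMeso
import HarnessLib

/-!
# Split of the crux `JParityClosure.OddContactSymmetry` into its mesoscale and its scale-bridge halves

Crux `JParityClosure.OddContactSymmetry` (stmt-AtomisticToContinuum-17722, rev 5), strategist
`planner-cstrat-stmt-AtomisticToContinuum-17722-s1-0` (2026-08-17).  The glue of the route-level split

  `OddContactSymmetry ⇐ MesoOddSymmetry ∧ OddScaleBridge`

where

* `MesoOddSymmetry` (child 1, the KINETIC half) is C⁺_w: the crux statistic read at the kinetic mesoscale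
  `r_K = K^{1/4}(N+1)^{-1/3}` (same `let`-chain, `metroOddStat`, framed exactly like the crux: classical hs-Euler
  solution, `t = 0` LLN tie, `τ < T`; and only for `ϑ < ϑ₀(η, δ)`) tends to `0` in local-Gibbs probability,
  `∃ K₀ ∀ K ≥ K₀ ∃ N₀ ∀ N ≥ N₀` — verbatim the hypothesis of the landed certificate
  `OddContactSymmetryKineticSlab.oddContactSymmetry_iff_scaleTransfer_of_meso` (p139703), and the weakest form of the
  frame-free conclusion of `mesoOddStat_of_slabPressure` (line `KineticSlabSketch`: S1a `stub_slabCentring` + S1b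
  `stub_slabPressureCentred` ⇒ it, all glue landed);
* `OddScaleBridge` (child 2, the HYDRODYNAMIC-REGULARITY half) is S6 `stub_scaleTransfer` verbatim: pre-shock, the
  statistic read at the fixed scale `r` and the one read at `r_K` differ by more than `η` with probability at most `δ`
  (`∃ r₀(η,δ) ∀ r ϑ < r₀ ∃ K₀ ∀ K ∃ N₀ ∀ N`).

The implication is one line over the landed certificate (`(iff h₁).2 h₂`).  The two hypotheses are spelled with fully
qualified names, byte-for-byte the `statement` texts of the two children filed by `ledger route edit --split`, so that
the generated route decls unfold to them definitionally.  Why the split (STRATEGY-CENSUS.md of the crux): child 1 is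
inside the reach of the route's LD engine (equilibrium super-exponential bound + `TransferInequality`), child 2 is
provably OUTSIDE it (its Gibbs large-deviation rate is linear in `η`: isobaric entropy patterns at scales between the
diffusive scale `(τ t_N)^{1/2}` and `r`), and is reached only through the relative-entropy form of the limit.
-/

noncomputable section

open scoped BigOperators Classical InnerProductSpace ENNReal Topology
open Set MeasureTheory Filter

namespace Summit.AtomisticToContinuum.HydrodynamicLimit.Theorems.OddContactSymmetrySplit

/-- **The crux from its two halves** (`<CruxDecl>_of_subs` of the strategist's split): the framed mesoscale odd symmetry
C⁺_w (`MesoOddSymmetry`) and the pre-shock two-scale bridge S6 (`OddScaleBridge`) imply `JParityClosure.OddContactSymmetry`,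
by the landed certificate `oddContactSymmetry_iff_scaleTransfer_of_meso` (union bound `|D_r| ≤ |D_r − D_{r_K}| + |D_{r_K}|` at
`(η/2, δ/2)`). [folklore] -/
theorem OddContactSymmetry_of_subs
    (h₁ : ∃ η₀ : ℝ, 0 < η₀ ∧ ∀ (a₀ θ₀ : Literature.MathematicalPhysics.KineticTheory.T3 → ℝ) (u₀ : Literature.MathematicalPhysics.KineticTheory.T3 → Literature.MathematicalPhysics.KineticTheory.V3), Continuous a₀ → Continuous θ₀ → Continuous u₀ → (∀ x, 0 < a₀ x) → (∀ x, 0 < θ₀ x) → ∃ σ₀ : ℝ, 0 < σ₀ ∧ ∀ σ : ℝ, 0 < σ → σ < σ₀ → ∀ (T : ℝ) (ρ θ : ℝ → Literature.MathematicalPhysics.KineticTheory.T3 → ℝ) (u : ℝ → Literature.MathematicalPhysics.KineticTheory.T3 → Literature.MathematicalPhysics.KineticTheory.V3), Literature.MathematicalPhysics.KineticTheory.IsHardSphereEulerSolution σ T ρ u θ → ∀ Φ : (N : ℕ) → Literature.Analysis.FluidPDE.HardSphereFlow (Literature.Analysis.FluidPDE.Torus.geometry (Fin 3)) (Literature.MathematicalPhysics.KineticTheory.hsDiameter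 σ N) (N + 1), Literature.MathematicalPhysics.KineticTheory.TendstoHydroFieldsAt (fun N => Literature.MathematicalPhysics.KineticTheory.localGibbsLaw σ a₀ u₀ θ₀ N (Φ N)) Φ ρ u θ 0 → ∀ τ : ℝ, 0 < τ → τ < T → ∀ χ : ℝ × UnitAddTorus (Fin 3) → ℝ, Continuous χ → ∀ g : ℝ → ℝ, Continuous g → (∀ a, η₀ ≤ a → g a = 0) → ∀ Ψ : EuclideanSpace ℝ (Fin 3) × EuclideanSpace ℝ (Fin 3) × EuclideanSpace ℝ (Fin 3) → ℝ, Continuous Ψ → (∃ C : ℝ, ∀ q, |Ψ q| ≤ C) → (∀ (n v w : EuclideanSpace ℝ (Fin 3)), ‖n‖ = 1 → Ψ (-n, (Literature.Analysis.FluidPDE.reflectVel n (v, w)).1, (Literature.Analysis.FluidPDE.reflectVel n (v, w)).2) = -Ψ (n, v, w)) → ∀ η δ : ℝ, 0 < η → 0 < δ → ∃ ϑ₀ : ℝ, 0 < ϑ₀ ∧ ∀ ϑ : ℝ, 0 < ϑ → ϑ < ϑ₀ → ∃ K₀ : ℕ, ∀ K : ℕ, K₀ ≤ K → ∃ N₀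 : ℕ, ∀ N : ℕ, N₀ ≤ N → Literature.MathematicalPhysics.KineticTheory.localGibbsLaw σ a₀ u₀ θ₀ N (Φ N) {z | η < |Literature.MathematicalPhysics.KineticTheory.metroOddStat σ N (Φ N) τ χ g Ψ ((K : ℝ) ^ (1 / 4 : ℝ) * ((N + 1 : ℕ) : ℝ) ^ (-(1 / 3 : ℝ))) ϑ z|} ≤ ENNReal.ofReal δ)
    (h₂ : ∃ η₀ : ℝ, 0 < η₀ ∧ ∀ (a₀ θ₀ : Literature.MathematicalPhysics.KineticTheory.T3 → ℝ) (u₀ : Literature.MathematicalPhysics.KineticTheory.T3 → Literature.MathematicalPhysics.KineticTheory.V3), Continuous a₀ → Continuous θ₀ → Continuous u₀ → (∀ x, 0 < a₀ x) → (∀ x, 0 < θ₀ x) → ∃ σ₀ : ℝ, 0 < σ₀ ∧ ∀ σ : ℝ, 0 < σ → σ < σ₀ → ∀ (T : ℝ) (ρ θ : ℝ → Literature.MathematicalPhysics.KineticTheory.T3 → ℝ) (u : ℝ → Literature.MathematicalPhysics.KineticTheory.T3 → Literature.MathematicalPhysics.KineticTheory.V3), Literature.MathematicalPhysics.KineticTheory.IsHardSphereEulerSolution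 σ T ρ u θ → ∀ Φ : (N : ℕ) → Literature.Analysis.FluidPDE.HardSphereFlow (Literature.Analysis.FluidPDE.Torus.geometry (Fin 3)) (Literature.MathematicalPhysics.KineticTheory.hsDiameter σ N) (N + 1), Literature.MathematicalPhysics.KineticTheory.TendstoHydroFieldsAt (fun N => Literature.MathematicalPhysics.KineticTheory.localGibbsLaw σ a₀ u₀ θ₀ N (Φ N)) Φ ρ u θ 0 → ∀ τ : ℝ, 0 < τ → τ < T → ∀ χ : ℝ × UnitAddTorus (Fin 3) → ℝ, Continuous χ → ∀ g : ℝ → ℝ, Continuous g → (∀ a, η₀ ≤ a → g a = 0) → ∀ Ψ : EuclideanSpace ℝ (Fin 3) × EuclideanSpace ℝ (Fin 3) × EuclideanSpace ℝ (Fin 3) → ℝ, Continuous Ψ → (∃ C : ℝ, ∀ q, |Ψ q| ≤ C) → (∀ (n v w : EuclideanSpace ℝ (Fin 3)), ‖n‖ = 1 → Ψ (-n, (Literature.Analysis.FluidPDE.reflectVel n (v, w)).1, (Literature.Analysis.FluidPDE.reflectVel n (v, w)).2) = -Ψ (n, v, w)) → ∀ η δ : ℝ, 0 < η → 0 < δ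 → ∃ r₀ : ℝ, 0 < r₀ ∧ ∀ r ϑ : ℝ, 0 < r → r < r₀ → 0 < ϑ → ϑ < r₀ → ∃ K₀ : ℕ, ∀ K : ℕ, K₀ ≤ K → ∃ N₀ : ℕ, ∀ N : ℕ, N₀ ≤ N → Literature.MathematicalPhysics.KineticTheory.localGibbsLaw σ a₀ u₀ θ₀ N (Φ N) {z | η < |Literature.MathematicalPhysics.KineticTheory.metroOddStat σ N (Φ N) τ χ g Ψ r ϑ z - Literature.MathematicalPhysics.KineticTheory.metroOddStat σ N (Φ N) τ χ g Ψ ((K : ℝ) ^ (1 / 4 : ℝ) * ((N + 1 : ℕ) : ℝ) ^ (-(1 / 3 : ℝ))) ϑ z|} ≤ ENNReal.ofReal δ) :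
    Summit.AtomisticToContinuum.HydrodynamicLimit.Theses.JParityClosure.OddContactSymmetry :=
  (OddContactSymmetryKineticSlab.oddContactSymmetry_iff_scaleTransfer_of_meso h₁).2 h₂

end Summit.AtomisticToContinuum.HydrodynamicLimit.Theorems.OddContactSymmetrySplit

end
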